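/-
Copyright (c) 2026 the pub-hodgecm-mathlib formalisation cell (harness21).  Prover seat hodgecm-mathlib-K2E4-p07 (g3), Track B «K2-LIT» ∕ h413
(stmt-HodgeConjecture-24833), ‹S› ROAD J ∕ R3 «RANK-ONE MASS», brick R3g «BLOCK MODEL OF THE COMPACT SHEET» — KIT: block change-of-basis algebra and the global
uniformizer read at an unramified non-split place.  2026-09-04.
-/
import Literature.NumberTheory.Automorphic.SelfDualLatticeCountFrameTransportCM     -- ★ `valued_toPlace_uniformizer`, `galAdicCompletionMap_toPlace_self`, parity∕norm tools at an unramified non-split place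
import Literature.NumberTheory.Automorphic.LocalHermitianPlaneAnisotropic           -- ★ `transpose_finSum_map`, `finSum` algebra (`UnitaryGroupDirectSum`)
import Literature.NumberTheory.Weil1982.UnitaryFinTopFormDensityProductRuleLie      -- ★ `finSum_mul_finSum`, `finSum_one`, `smul_finSum`, `finSum_inj`
import Literature.NumberTheory.Automorphic.LocalEndoscopicOrbitClosed               -- ★ `matrix_fin_one_comm`
import Literature.NumberTheory.Automorphic.QuadraticLocalBaseChange                 -- ★ `toLocalRing`, `toLocalRing_coe`, `conjLocal_toLocalRing`
import Literature.NumberTheory.Automorphic.UnitaryGroupFormTransport                -- ★ `formCongr`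
import HarnessLib

/-!
# ‹S› road J ∕ R3 (R3g) KIT — block change of basis `T = P′·(S₁ ⊕ᶠ S₂)` and the GLOBAL uniformizer `ξ = ϖ_v ∈ L⁺` read in `L ⊗ L⁺_v` and `L_w`

Cell `pub/hodgecm-mathlib`, Track B «K2-LIT», crux H413 = `stmt-HodgeConjecture-24833`; ‹S› ROAD J, letter ‹J3› (v2), payer road R3 «RANK-ONE MASS» (owner K2E3-p15 (g2));
brick R3g «BLOCK MODEL OF THE COMPACT SHEET» (K2E3-plan (g2) 01:04:01Z ∕ K2E3-p15 (g2) 01:12:33Z → K2E4-p07 (g3)): from the bad frame `(P′, G₁′, G₂′)` of the κ-block produce the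
`(Ha, Hb, T, hT, x, hab, hx, hy)` block model of the compact sheet `ε′` consumed by ★ p856281 `K2E3CentralizerTamagawaPartnerBlockProduct.finTamagawaPartner_univ_eq_mul_of_blockModel`.
THIS FILE = the frame-free KIT; the head is `Theorems/K2E3CompactSheetBlockModel.lean`.  THEOREMS ONLY (no definition, no instance, no notation, no `sorry`).

* §1 (any commutative ring) `exists_gl_val_eq_finSum` — the block-diagonal unit `S₁ ⊕ᶠ S₂ ∈ GL₃` with its inverse; `formCongr_mul_of_finSum` — a frame `T` with
  `ᵗ(σT)·H·T = G₁ ⊕ᶠ G₂` followed by a block change `S₁ ⊕ᶠ S₂` gives `ᵗσ(S₁)G₁S₁ ⊕ᶠ ᵗσ(S₂)G₂S₂`; `finSum_inv_mul_scalar_mul` — a block-scalar matrix `a•1 ⊕ᶠ M` (`M` 1×1) is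
  fixed under conjugation by `S₁ ⊕ᶠ S₂`.
* §2 (CM field `L`, finite place `v` of `L⁺` unramified and non-split in `L`, `w ∣ v`) the GLOBAL uniformizer `ξ := ϖ_v ∈ L⁺` of ★ `HeckeCharacter.uniformizer` read in
  `L ⊗ L⁺_v` and in `L_w`: `complexConj ξ = ξ`, `ι ξ = ι_v(ϖ_v)`, `|ξ|_w = exp(−1)`, `(c ⊗ 1)(ι ξ) = ι ξ`.

HONEST LABEL: HC_CM is proved only modulo the 7 printed citations (2 remaining named inputs: hLiu418 = stmt-HodgeConjecture-24832, h413 =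
stmt-HodgeConjecture-24833) until rung 0 closes; this file is a `--supports stmt-HodgeConjecture-24833` helper of pure algebra ∕ valuation bookkeeping.

## References
* [PlatonovRapinchuk1994] V. Platonov, A. Rapinchuk, *Algebraic Groups and Number Theory* (1994), §2.3 (change of basis for hermitian forms), §5.1.
* [NeukirchANT1999] J. Neukirch, *Algebraic Number Theory* (1999), Ch. II §6 (unramified extensions: a uniformizer of `F_v` stays one in `E_w`).
* [Rogawski1990] J. D. Rogawski, *Automorphic Representations of Unitary Groups in Three Variables*, Ann. of Math. Stud. 123 (1990), §3.8 Prop. 3.8.1 (a) p. 30; §8.1 p. 116.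
-/

set_option autoImplicit false
set_option linter.dupNamespace false

noncomputable section

open NumberField IsDedekindDomain Matrix
open Literature.NumberTheory.Automorphic Literature.NumberTheory.Automorphic.UnitaryGroup Literature.NumberTheory.GaloisRepresentations
open Literature.NumberTheory.Weil1982.UnitaryFinTopForm
open scoped MatrixGroups

namespace Summit.HodgeConjecture.HodgeConjecture.Cruxes.H413.K2E3CompactSheetBlockModelKit

/-! ## §1 Block change of basis -/

section Blocks

variable {R : Type*} [CommRing R] (σ : R →+* R)

/-- **The block-diagonal unit `S₁ ⊕ᶠ S₂ ∈ GL_{2+1}(R)`** with `(S₁ ⊕ᶠ S₂)⁻¹ = S₁⁻¹ ⊕ᶠ S₂⁻¹`. [cite: PlatonovRapinchuk1994, §2.3] -/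
theorem exists_gl_val_eq_finSum (S₁ : GL (Fin 2) R) (S₂ : GL (Fin 1) R) :
    ∃ S : GL (Fin (2 + 1)) R, S.val = finSum 2 1 S₁.val S₂.val ∧ (S⁻¹).val = finSum 2 1 (S₁⁻¹).val (S₂⁻¹).val := by
  refine ⟨⟨finSum 2 1 S₁.val S₂.val, finSum 2 1 (S₁⁻¹).val (S₂⁻¹).val, ?_, ?_⟩, rfl, rfl⟩
  · rw [finSum_mul_finSum, Units.mul_inv, Units.mul_inv, finSum_one]
  · rw [finSum_mul_finSum, Units.inv_mul, Units.inv_mul, finSum_one]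

/-- **A frame followed by a block change**: if `ᵗ(σT)·H·T = G₁ ⊕ᶠ G₂` and `S = S₁ ⊕ᶠ S₂` then `ᵗ(σ(TS))·H·(TS) = ᵗσ(S₁)G₁S₁ ⊕ᶠ ᵗσ(S₂)G₂S₂`.
[cite: PlatonovRapinchuk1994, §2.3] -/
theorem formCongr_mul_of_finSum (H : Matrix (Fin (2 + 1)) (Fin (2 + 1)) R) (T S : GL (Fin (2 + 1)) R) (S₁ : GL (Fin 2) R) (S₂ : GL (Fin 1) R)
    {G₁ : Matrix (Fin 2) (Fin 2) R} {G₂ : Matrix (Fin 1) (Fin 1) R}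
    (hT : formCongr σ T H = finSum 2 1 G₁ G₂) (hS : S.val = finSum 2 1 S₁.val S₂.val) :
    formCongr σ (T * S) H = finSum 2 1 (formCongr σ S₁ G₁) (formCongr σ S₂ G₂) := by
  have h1 : formCongr σ (T * S) H = ((S.val).map σ)ᵀ * formCongr σ T H * S.val := by
    simp only [formCongr, Units.val_mul, Matrix.map_mul, Matrix.transpose_mul, Matrix.mul_assoc]
  rw [h1, hT, hS, transpose_finSum_map, finSum_mul_finSum, finSum_mul_finSum]

/-- **Block-scalar points are fixed by block conjugation**: `(S₁ ⊕ᶠ S₂)⁻¹ · (a•1 ⊕ᶠ M) · (S₁ ⊕ᶠ S₂) = a•1 ⊕ᶠ M` (`M` is `1 × 1`, so central).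
[cite: Rogawski1990, §3.8 Prop. 3.8.1 (a) p. 30] -/
theorem finSum_inv_mul_scalar_mul (S : GL (Fin (2 + 1)) R) (S₁ : GL (Fin 2) R) (S₂ : GL (Fin 1) R)
    (hS : S.val = finSum 2 1 S₁.val S₂.val) (hSi : (S⁻¹).val = finSum 2 1 (S₁⁻¹).val (S₂⁻¹).val) (a : R) (M : Matrix (Fin 1) (Fin 1) R) :
    (S⁻¹).val * finSum 2 1 (a • (1 : Matrix (Fin 2) (Fin 2) R)) M * S.val = finSum 2 1 (a • (1 : Matrix (Fin 2) (Fin 2) R)) M := by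
  rw [hS, hSi, finSum_mul_finSum, finSum_mul_finSum, Matrix.mul_smul, Matrix.mul_one, Matrix.smul_mul, Units.inv_mul,
    Literature.NumberTheory.Rogawski1990.matrix_fin_one_comm ((S₂⁻¹).val * M) S₂.val, ← Matrix.mul_assoc, ← Units.val_mul, mul_inv_cancel, Units.val_one, Matrix.one_mul]

/-- The same for the forward conjugation: `(S₁ ⊕ᶠ S₂) · (a•1 ⊕ᶠ M) · (S₁ ⊕ᶠ S₂)⁻¹ = a•1 ⊕ᶠ M`. [cite: Rogawski1990, §3.8 Prop. 3.8.1 (a) p. 30] -/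
theorem finSum_mul_scalar_mul_inv (S : GL (Fin (2 + 1)) R) (S₁ : GL (Fin 2) R) (S₂ : GL (Fin 1) R)
    (hS : S.val = finSum 2 1 S₁.val S₂.val) (hSi : (S⁻¹).val = finSum 2 1 (S₁⁻¹).val (S₂⁻¹).val) (a : R) (M : Matrix (Fin 1) (Fin 1) R) :
    S.val * finSum 2 1 (a • (1 : Matrix (Fin 2) (Fin 2) R)) M * (S⁻¹).val = finSum 2 1 (a • (1 : Matrix (Fin 2) (Fin 2) R)) M := by
  rw [hS, hSi, finSum_mul_finSum, finSum_mul_finSum, Matrix.mul_smul, Matrix.mul_one, Matrix.smul_mul, Units.mul_inv,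
    Literature.NumberTheory.Rogawski1990.matrix_fin_one_comm (S₂.val * M) (S₂⁻¹).val, ← Matrix.mul_assoc, ← Units.val_mul, inv_mul_cancel, Units.val_one, Matrix.one_mul]

/-- A `1 × 1` matrix is the scalar matrix of its entry. [folklore] -/
theorem fin_one_eq_smul_one (M : Matrix (Fin 1) (Fin 1) R) : M = M 0 0 • (1 : Matrix (Fin 1) (Fin 1) R) := by
  ext i j
  fin_cases i; fin_cases j
  simp

end Blocks

/-! ## §2 The global uniformizer `ξ = ϖ_v ∈ L⁺` at an unramified non-split place -/

section Uniformizer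

variable (L : Type) [Field L] [NumberField L] [IsCMField L] (v : HeightOneSpectrum (𝓞 ↥(maximalRealSubfield L)))
  (w : PlacesOver L v) (hw : IsCMField.complexConj L • w.1 = w.1)

/-- **THE GLOBAL UNIFORMIZER `ξ := ϖ_v ∈ L⁺ ⊂ L`** (Mathlib's chosen `π ∈ L⁺` with `v(π) = 1`, the element under ★ `HeckeCharacter.uniformizer L⁺ v`): it is `complexConj`-fixed, its image
in `L ⊗ L⁺_v` is `ι_v(ϖ_v)` (★ `toLocalRing_coe`), hence `(c ⊗ 1)`-fixed, and at a place `w ∣ v` UNRAMIFIED in `L` it is a uniformizer of `L_w`: `|ξ|_w = exp(−1)` (★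
`valued_toPlace_uniformizer`). [cite: NeukirchANT1999, Ch. II §6] -/
theorem exists_global_uniformizer (hunr : Algebra.IsUnramifiedIn (𝓞 L) v.asIdeal) :
    ∃ ξ : L, IsCMField.complexConj L ξ = ξ ∧
      algebraMap L (LocalRing L v) ξ =
        toLocalRing L v (HeckeCharacter.uniformizer ↥(maximalRealSubfield L) v : v.adicCompletion ↥(maximalRealSubfield L)) ∧
      Valued.v (algebraMap L (w.1.adicCompletion L) ξ) = WithZero.exp (-1 : ℤ) ∧
      conjLocal L (IsCMField.complexConj L) v (algebraMap L (LocalRing L v) ξ) = algebraMap L (LocalRing L v) ξ := by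
  set π : ↥(maximalRealSubfield L) := (v.valuation_exists_uniformizer ↥(maximalRealSubfield L)).choose with hπ
  have hcoe : (HeckeCharacter.uniformizer ↥(maximalRealSubfield L) v : v.adicCompletion ↥(maximalRealSubfield L)) =
      ((π : ↥(maximalRealSubfield L)) : v.adicCompletion ↥(maximalRealSubfield L)) := rfl
  have hloc : algebraMap L (LocalRing L v) (π : L) =
      toLocalRing L v (HeckeCharacter.uniformizer ↥(maximalRealSubfield L) v : v.adicCompletion ↥(maximalRealSubfield L)) := by
    rw [hcoe, toLocalRing_coe]; rfl
  refine ⟨(π : L), IsCMField.complexConj_apply_eq_self (K := L) π, hloc, ?_, ?_⟩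
  · have h := valued_toPlace_uniformizer L v w hunr
    have hw' : (algebraMap L (LocalRing L v) (π : L)) w = algebraMap L (w.1.adicCompletion L) (π : L) := rfl
    rw [← hw', hloc, toLocalRing_apply]
    exact h
  · rw [hloc, conjLocal_toLocalRing]

end Uniformizer

end Summit.HodgeConjecture.HodgeConjecture.Cruxes.H413.K2E3CompactSheetBlockModelKit

end
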